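import Summits.NavierStokesRegularity.NavierStokesRegularity.Theorems.WakeRatchetEternalViscousRateCircuitPumpAtScale

/-!
# `WakeRatchet.EternalViscousRate` (stmt-NavierStokesRegularity-25647): the inner statement FAILS AT EVERY SCALE RATIO
# `ε₀ ∈ (0, (3/2)^{2/5} − 1]` (for some spread) — sharpening of `eternalViscousRate_no_uniform_threshold` (p827286)

`EternalViscousRate` reads `∀ R ≥ 1, ∃ a > 1, ∃ εs > 0, ∀ ε₀ ∈ (0, εs], ∀ α ∈ E₂(R), ∀ ν̂ > 0, ∀ W` (uniformly bounded admissible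
eternal solution with covariant viscosity `ν̂`) «tail above `n` bounded by `M` at all log-times ⇒ tail above `n+1` bounded by
`(1+ε₀)^{-a} M`».  `eternalViscousRate_no_uniform_threshold` (…CircuitPumpTodaWitness) refutes the SPREAD-UNIFORM strengthening
along SOME sequence of scale ratios.  With the pump available at every prescribed `lam ∈ (1, 3/2]` (`todaPump_at`,
…CircuitPumpAtScale) the failure set is the whole interval:

* `eternalViscousRate_fails_at_scale` — for EVERY `ε₀ > 0` with `(1+ε₀)^{5/2} ≤ 3/2` (`ε₀ ≤ (3/2)^{2/5} − 1 ≈ 0.176`) and EVERY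
  `a > 1` there are `R ≥ 1`, `α ∈ E₂(R)` (the padded Toda member `T_ε`, `R = 2/ε`) and a uniformly bounded admissible eternal `W` with
  `ν̂ = 1` (the renormalised pump of scale ratio `lam = (1+ε₀)^{5/2}`) along which the rate-`a` tail contraction FAILS
  (padding `…CircuitPumpPad/PadClass`, class `…CircuitPumpTodaClass`, kill `not_rateContraction_of_pumpWitness₂`; the renormalised
  scale ratio of the witness is identified with the prescribed one by injectivity of `x ↦ x^{5/2}`);
* `eternalViscousRate_badScales_all` — hence for every such `ε₀` and every `a > 1` the block
  `∀ R ≥ 1, ∀ α ∈ E₂(R), ∀ ν̂ > 0, ∀ W …, (rate-a contraction)` is FALSE.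

READING (census for ⟨25647⟩).  The crux cannot be rescued by excluding exceptional scale ratios: at EVERY fine `ε₀` some comparable
table carries a dissipation-balanced block-DSS pump killing every rate `a > 1`.  It survives only through the dependence of the
threshold on the spread, `εs = εs(R) → 0` — i.e. as the statement «at FIXED spread the pump needs `ε₀` bounded below», whose negation
is the open construction (clock box of the Toda pump uniform in `lam ↓ 1` at fixed seed; HAND9 census item (d)).
HONEST LABEL: MODEL lattice ODEs only (Tao 2016 §4, §6.4); ⟨25647⟩ itself is neither proved nor refuted; no registered stub of
skeleton 842b1374 is closed; nothing here bears on the Navier–Stokes equations.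
-/

set_option linter.dupNamespace false

noncomputable section

open Set

namespace Summit.NavierStokesRegularity.NavierStokesRegularity.Theorems.WakeRatchetCircuitPumpNoUniform

open scoped BigOperators
open Real Filter Topology MeasureTheory
open Summit.NavierStokesRegularity.NavierStokesRegularity.Theorems.CircuitPumpNegative
open Summit.NavierStokesRegularity.NavierStokesRegularity.Theorems.PerpetualPumpCircuitPump
open Summit.NavierStokesRegularity.NavierStokesRegularity.Theorems.WakeRatchetCircuitPumpBdd
open Summit.NavierStokesRegularity.NavierStokesRegularity.Theorems.WakeRatchetCircuitPumpTable
open Summit.NavierStokesRegularity.NavierStokesRegularity.Theorems.WakeRatchetCircuitPumpAssembly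
open Summit.NavierStokesRegularity.NavierStokesRegularity.Theorems.WakeRatchetCircuitPumpAction
open Summit.NavierStokesRegularity.NavierStokesRegularity.Theorems.WakeRatchetCircuitPumpKill
open Summit.NavierStokesRegularity.NavierStokesRegularity.Theorems.WakeRatchetCircuitPumpPad
open Summit.NavierStokesRegularity.NavierStokesRegularity.Theorems.WakeRatchetCircuitPumpPadClass
open Summit.NavierStokesRegularity.NavierStokesRegularity.Theorems.WakeRatchetCircuitPumpTodaClass
open Summit.NavierStokesRegularity.NavierStokesRegularity.Theorems.WakeRatchetViscDSS
open Literature.Analysis.FluidPDE Literature.Analysis.FluidPDE.TaoCascade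

/-- **⟨25647⟩ fails at EVERY fine scale ratio, for some spread.**  For every `ε₀ > 0` with `(1+ε₀)^{5/2} ≤ 3/2` and every rate
`a > 1` there are `R ≥ 1`, a table `α ∈ E₂(R)` (the Toda member `T_ε`, padded to `Fin 4`, `R = 2/ε`) and a uniformly bounded admissible
eternal solution `W` with covariant viscosity `ν̂ = 1` (the renormalised perpetual pump of scale ratio `lam = (1+ε₀)^{5/2}`) along which
the rate-`a` tail contraction of `EternalViscousRate` fails.  MODEL lattice only.
[cite: Tao2016AveragedNS, §4 Thm. 4.2 (statement shape), the viscous equation before it, §6.4; cell vocabulary (stmt-NavierStokesRegularity-25647)] -/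
theorem eternalViscousRate_fails_at_scale (ε₀ : ℝ) (hε₀ : 0 < ε₀) (hε₀le : (1 + ε₀) ^ ((5 : ℝ) / 2) ≤ 3 / 2)
    (a : ℝ) (ha : 1 < a) :
    ∃ R : ℝ, 1 ≤ R ∧ ∃ α : Fin 4 → Fin 4 → Fin 4 → ℤ × ℤ × ℤ → ℝ, InTableClass R α ∧
      ∃ W : ℤ → ℝ → Em 4, IsEternalVisc ε₀ 1 α W ∧ UniformBound W ∧
        ¬ ∀ (n : ℤ) (M : ℝ), (∀ σ : ℝ, ∑' k : ℕ, physEnergy ε₀ W (n + k) σ ≤ M) →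
            ∀ σ : ℝ, ∑' k : ℕ, physEnergy ε₀ W (n + 1 + k) σ ≤ (1 + ε₀) ^ (-a) * M := by
  have hlam : (1 : ℝ) < (1 + ε₀) ^ ((5 : ℝ) / 2) := Real.one_lt_rpow (by linarith) (by norm_num)
  obtain ⟨ε, hε, hε5, X, hode, hdss, hTI, hnt⟩ := todaPump_at _ hlam hε₀le
  have hbd := shellBound_of_typeI hlam _ X hode hTI
  generalize hlamdef : (1 + ε₀) ^ ((5 : ℝ) / 2) = lam at hlam hode hdss hTI hbd
  -- pad to four modes
  have hode₄ := solvesODE_pad (k := 2) hode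
  have hdss₄ := isDSS_pad (k := 2) hdss
  have hTI₄ := isTypeI_pad (k := 2) hlam hTI
  have hnt₄ := isNontrivial_pad (k := 2) hnt
  have hbd₄ : ∀ n : ℤ, ∃ P : ℝ, ∀ t : ℝ, -(1 / 2) ≤ t → t < 0 →
      ‖shellVec (Fin.append X (fun (_ : Fin 2) (_ : ℤ) (_ : ℝ) => (0 : ℝ))) n t‖ ≤ P := by
    intro n
    obtain ⟨P, hP⟩ := hbd n
    exact ⟨P, fun t h1 h2 => by rw [norm_shellVec_pad]; exact hP t h1 h2⟩
  -- the padded pulled-back table is the padding of the m = 2 Toda member of `E₂(2/ε)`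
  have hε1 : ε ≤ 1 := by linarith
  have h2 : InTableClass (2 / ε) (fun (i₁ i₂ i₃ : Fin 2) (μ : ℤ × ℤ × ℤ) =>
            if μ = (0, 0, 0) then (fun (i₁ i₂ i₃ : Fin 2) (μ : Option (Fin 3)) => if μ = none then (if i₁ = 1 ∧ i₂ = 1 ∧ i₃ = 0
              then (-1 : ℝ) else if i₁ = 1 ∧ i₂ = 0 ∧ i₃ = 1 then 1 / 2 else if i₁ = 0 ∧ i₂ = 1 ∧ i₃ = 1
              then 1 / 2 else if i₁ = 0 ∧ i₂ = 0 ∧ i₃ = 1 then ε else if i₁ = 0 ∧ i₂ = 1 ∧ i₃ = 0 then -ε /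
              2 else if i₁ = 1 ∧ i₂ = 0 ∧ i₃ = 0 then -ε / 2 else 0) else if μ = some 2 then (if i₁ = 1 ∧
              i₂ = 1 ∧ i₃ = 0 then 1 else 0) else if μ = some 1 then (if i₁ = 1 ∧ i₂ = 0 ∧ i₃ = 1 then -1 /
              2 else 0) else (if i₁ = 0 ∧ i₂ = 1 ∧ i₃ = 1 then -1 / 2 else 0)) i₁ i₂ i₃ none
            else if μ = (1, 0, 0) then (fun (i₁ i₂ i₃ : Fin 2) (μ : Option (Fin 3)) => if μ = none then (if i₁ = 1 ∧ i₂ = 1 ∧ i₃ = 0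
              then (-1 : ℝ) else if i₁ = 1 ∧ i₂ = 0 ∧ i₃ = 1 then 1 / 2 else if i₁ = 0 ∧ i₂ = 1 ∧ i₃ = 1
              then 1 / 2 else if i₁ = 0 ∧ i₂ = 0 ∧ i₃ = 1 then ε else if i₁ = 0 ∧ i₂ = 1 ∧ i₃ = 0 then -ε /
              2 else if i₁ = 1 ∧ i₂ = 0 ∧ i₃ = 0 then -ε / 2 else 0) else if μ = some 2 then (if i₁ = 1 ∧
              i₂ = 1 ∧ i₃ = 0 then 1 else 0) else if μ = some 1 then (if i₁ = 1 ∧ i₂ = 0 ∧ i₃ = 1 then -1 /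
              2 else 0) else (if i₁ = 0 ∧ i₂ = 1 ∧ i₃ = 1 then -1 / 2 else 0)) i₁ i₂ i₃ (some 0)
            else if μ = (0, 1, 0) then (fun (i₁ i₂ i₃ : Fin 2) (μ : Option (Fin 3)) => if μ = none then (if i₁ = 1 ∧ i₂ = 1 ∧ i₃ = 0
              then (-1 : ℝ) else if i₁ = 1 ∧ i₂ = 0 ∧ i₃ = 1 then 1 / 2 else if i₁ = 0 ∧ i₂ = 1 ∧ i₃ = 1
              then 1 / 2 else if i₁ = 0 ∧ i₂ = 0 ∧ i₃ = 1 then ε else if i₁ = 0 ∧ i₂ = 1 ∧ i₃ = 0 then -ε /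
              2 else if i₁ = 1 ∧ i₂ = 0 ∧ i₃ = 0 then -ε / 2 else 0) else if μ = some 2 then (if i₁ = 1 ∧
              i₂ = 1 ∧ i₃ = 0 then 1 else 0) else if μ = some 1 then (if i₁ = 1 ∧ i₂ = 0 ∧ i₃ = 1 then -1 /
              2 else 0) else (if i₁ = 0 ∧ i₂ = 1 ∧ i₃ = 1 then -1 / 2 else 0)) i₁ i₂ i₃ (some 1)
            else if μ = (0, 0, 1) then (fun (i₁ i₂ i₃ : Fin 2) (μ : Option (Fin 3)) => if μ = none then (if i₁ = 1 ∧ i₂ = 1 ∧ i₃ = 0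
              then (-1 : ℝ) else if i₁ = 1 ∧ i₂ = 0 ∧ i₃ = 1 then 1 / 2 else if i₁ = 0 ∧ i₂ = 1 ∧ i₃ = 1
              then 1 / 2 else if i₁ = 0 ∧ i₂ = 0 ∧ i₃ = 1 then ε else if i₁ = 0 ∧ i₂ = 1 ∧ i₃ = 0 then -ε /
              2 else if i₁ = 1 ∧ i₂ = 0 ∧ i₃ = 0 then -ε / 2 else 0) else if μ = some 2 then (if i₁ = 1 ∧
              i₂ = 1 ∧ i₃ = 0 then 1 else 0) else if μ = some 1 then (if i₁ = 1 ∧ i₂ = 0 ∧ i₃ = 1 then -1 /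
              2 else 0) else (if i₁ = 0 ∧ i₂ = 1 ∧ i₃ = 1 then -1 / 2 else 0)) i₁ i₂ i₃ (some 2) else 0) := by
    rw [toda_pullback_eq ε]
    exact todaTable_inTableClass ε hε hε1
  have hclass : InTableClass (2 / ε) (fun (j₁ j₂ j₃ : Fin (2 + 2)) (μ : ℤ × ℤ × ℤ) =>
            if μ = (0, 0, 0) then (Fin.append (fun i₁ : Fin 2 => Fin.append (fun i₂ : Fin 2 => Fin.append ((fun (i₁ i₂ i₃ : Fin 2) (μ : Option (Fin 3)) => if μ = none then (if i₁ = 1 ∧ i₂ = 1 ∧ i₃ = 0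
              then (-1 : ℝ) else if i₁ = 1 ∧ i₂ = 0 ∧ i₃ = 1 then 1 / 2 else if i₁ = 0 ∧ i₂ = 1 ∧ i₃ = 1
              then 1 / 2 else if i₁ = 0 ∧ i₂ = 0 ∧ i₃ = 1 then ε else if i₁ = 0 ∧ i₂ = 1 ∧ i₃ = 0 then -ε /
              2 else if i₁ = 1 ∧ i₂ = 0 ∧ i₃ = 0 then -ε / 2 else 0) else if μ = some 2 then (if i₁ = 1 ∧
              i₂ = 1 ∧ i₃ = 0 then 1 else 0) else if μ = some 1 then (if i₁ = 1 ∧ i₂ = 0 ∧ i₃ = 1 then -1 /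
              2 else 0) else (if i₁ = 0 ∧ i₂ = 1 ∧ i₃ = 1 then -1 / 2 else 0)) i₁ i₂)
              (fun (_ : Fin 2) (_ : Option (Fin 3)) => (0 : ℝ)))
            (fun (_ : Fin 2) (_ : Fin (2 + 2)) (_ : Option (Fin 3)) => (0 : ℝ)))
            (fun (_ : Fin 2) (_ : Fin (2 + 2)) (_ : Fin (2 + 2)) (_ : Option (Fin 3)) => (0 : ℝ))) j₁ j₂ j₃ none
            else if μ = (1, 0, 0) then (Fin.append (fun i₁ : Fin 2 => Fin.append (fun i₂ : Fin 2 => Fin.append ((fun (i₁ i₂ i₃ : Fin 2) (μ : Option (Fin 3)) => if μ = none then (if i₁ = 1 ∧ i₂ = 1 ∧ i₃ = 0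
              then (-1 : ℝ) else if i₁ = 1 ∧ i₂ = 0 ∧ i₃ = 1 then 1 / 2 else if i₁ = 0 ∧ i₂ = 1 ∧ i₃ = 1
              then 1 / 2 else if i₁ = 0 ∧ i₂ = 0 ∧ i₃ = 1 then ε else if i₁ = 0 ∧ i₂ = 1 ∧ i₃ = 0 then -ε /
              2 else if i₁ = 1 ∧ i₂ = 0 ∧ i₃ = 0 then -ε / 2 else 0) else if μ = some 2 then (if i₁ = 1 ∧
              i₂ = 1 ∧ i₃ = 0 then 1 else 0) else if μ = some 1 then (if i₁ = 1 ∧ i₂ = 0 ∧ i₃ = 1 then -1 /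
              2 else 0) else (if i₁ = 0 ∧ i₂ = 1 ∧ i₃ = 1 then -1 / 2 else 0)) i₁ i₂)
              (fun (_ : Fin 2) (_ : Option (Fin 3)) => (0 : ℝ)))
            (fun (_ : Fin 2) (_ : Fin (2 + 2)) (_ : Option (Fin 3)) => (0 : ℝ)))
            (fun (_ : Fin 2) (_ : Fin (2 + 2)) (_ : Fin (2 + 2)) (_ : Option (Fin 3)) => (0 : ℝ))) j₁ j₂ j₃ (some 0)
            else if μ = (0, 1, 0) then (Fin.append (fun i₁ : Fin 2 => Fin.append (fun i₂ : Fin 2 => Fin.append ((fun (i₁ i₂ i₃ : Fin 2) (μ : Option (Fin 3)) => if μ = none then (if i₁ = 1 ∧ i₂ = 1 ∧ i₃ = 0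
              then (-1 : ℝ) else if i₁ = 1 ∧ i₂ = 0 ∧ i₃ = 1 then 1 / 2 else if i₁ = 0 ∧ i₂ = 1 ∧ i₃ = 1
              then 1 / 2 else if i₁ = 0 ∧ i₂ = 0 ∧ i₃ = 1 then ε else if i₁ = 0 ∧ i₂ = 1 ∧ i₃ = 0 then -ε /
              2 else if i₁ = 1 ∧ i₂ = 0 ∧ i₃ = 0 then -ε / 2 else 0) else if μ = some 2 then (if i₁ = 1 ∧
              i₂ = 1 ∧ i₃ = 0 then 1 else 0) else if μ = some 1 then (if i₁ = 1 ∧ i₂ = 0 ∧ i₃ = 1 then -1 /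
              2 else 0) else (if i₁ = 0 ∧ i₂ = 1 ∧ i₃ = 1 then -1 / 2 else 0)) i₁ i₂)
              (fun (_ : Fin 2) (_ : Option (Fin 3)) => (0 : ℝ)))
            (fun (_ : Fin 2) (_ : Fin (2 + 2)) (_ : Option (Fin 3)) => (0 : ℝ)))
            (fun (_ : Fin 2) (_ : Fin (2 + 2)) (_ : Fin (2 + 2)) (_ : Option (Fin 3)) => (0 : ℝ))) j₁ j₂ j₃ (some 1)
            else if μ = (0, 0, 1) then (Fin.append (fun i₁ : Fin 2 => Fin.append (fun i₂ : Fin 2 => Fin.append ((fun (i₁ i₂ i₃ : Fin 2) (μ : Option (Fin 3)) => if μ = none then (if i₁ = 1 ∧ i₂ = 1 ∧ i₃ = 0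
              then (-1 : ℝ) else if i₁ = 1 ∧ i₂ = 0 ∧ i₃ = 1 then 1 / 2 else if i₁ = 0 ∧ i₂ = 1 ∧ i₃ = 1
              then 1 / 2 else if i₁ = 0 ∧ i₂ = 0 ∧ i₃ = 1 then ε else if i₁ = 0 ∧ i₂ = 1 ∧ i₃ = 0 then -ε /
              2 else if i₁ = 1 ∧ i₂ = 0 ∧ i₃ = 0 then -ε / 2 else 0) else if μ = some 2 then (if i₁ = 1 ∧
              i₂ = 1 ∧ i₃ = 0 then 1 else 0) else if μ = some 1 then (if i₁ = 1 ∧ i₂ = 0 ∧ i₃ = 1 then -1 /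
              2 else 0) else (if i₁ = 0 ∧ i₂ = 1 ∧ i₃ = 1 then -1 / 2 else 0)) i₁ i₂)
              (fun (_ : Fin 2) (_ : Option (Fin 3)) => (0 : ℝ)))
            (fun (_ : Fin 2) (_ : Fin (2 + 2)) (_ : Option (Fin 3)) => (0 : ℝ)))
            (fun (_ : Fin 2) (_ : Fin (2 + 2)) (_ : Fin (2 + 2)) (_ : Option (Fin 3)) => (0 : ℝ))) j₁ j₂ j₃ (some 2) else 0) := by
    rw [pullback_pad_comm]
    exact inTableClass_pad (k := 2) h2
  -- kill at `ε₀ = lam^{2/5} - 1`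
  obtain ⟨ε₁, W, hε₁, hlamε, hW, hUB, hnot⟩ :=
    not_rateContraction_of_pumpWitness₂ hlam _ hclass.2.1 _ hode₄ hdss₄ hTI₄ hnt₄ hbd₄ ha
  -- the renormalised scale ratio of the witness is the prescribed one
  have h10 : (0 : ℝ) ≤ 1 + ε₀ := by linarith
  have h11 : (0 : ℝ) ≤ 1 + ε₁ := by linarith
  have h52 : (0 : ℝ) < (5 : ℝ) / 2 := by norm_num
  have hpow : (1 + ε₁) ^ ((5 : ℝ) / 2) = (1 + ε₀) ^ ((5 : ℝ) / 2) := by rw [hlamε, hlamdef]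
  have heq : ε₁ = ε₀ := by
    have hA := (Real.rpow_le_rpow_iff h11 h10 h52).1 hpow.le
    have hB := (Real.rpow_le_rpow_iff h10 h11 h52).1 hpow.ge
    linarith
  subst heq
  have hR : (1 : ℝ) ≤ 2 / ε := by
    rw [le_div_iff₀ hε]; linarith
  exact ⟨2 / ε, hR, _, hclass, W, hW, hUB, hnot⟩

/-- **Every fine scale ratio is a bad scale for the inner block of ⟨25647⟩.**  For every `ε₀ > 0` with `(1+ε₀)^{5/2} ≤ 3/2`
and every `a > 1`, the statement «for all spreads `R ≥ 1`, all `α ∈ E₂(R)`, all `ν̂ > 0` and all uniformly bounded admissible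
eternal `W` with covariant viscosity `ν̂`, the tail envelope contracts by `(1+ε₀)^{-a}`» is FALSE.  Consequently any proof of
`EternalViscousRate` must use a threshold `εs(R)` that EXCLUDES, at each spread `R`, every scale ratio whose Toda member lies in
`E₂(R)` — the crux lives entirely in the dependence of the threshold on the spread.  MODEL lattice only; ⟨25647⟩ is neither proved
nor refuted here.
[cite: Tao2016AveragedNS, §4 Thm. 4.2 (statement shape), the viscous equation before it, §6.4; cell vocabulary (stmt-NavierStokesRegularity-25647)] -/
theorem eternalViscousRate_badScales_all (ε₀ : ℝ) (hε₀ : 0 < ε₀) (hε₀le : (1 + ε₀) ^ ((5 : ℝ) / 2) ≤ 3 / 2)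
    (a : ℝ) (ha : 1 < a) :
    ¬ ∀ R : ℝ, 1 ≤ R → ∀ α : Fin 4 → Fin 4 → Fin 4 → ℤ × ℤ × ℤ → ℝ, InTableClass R α →
        ∀ (νh : ℝ) (W : ℤ → ℝ → Em 4), 0 < νh → IsEternalVisc ε₀ νh α W → UniformBound W →
        ∀ (n : ℤ) (M : ℝ), (∀ σ : ℝ, ∑' k : ℕ, physEnergy ε₀ W (n + k) σ ≤ M) →
          ∀ σ : ℝ, ∑' k : ℕ, physEnergy ε₀ W (n + 1 + k) σ ≤ (1 + ε₀) ^ (-a) * M := by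
  intro h
  obtain ⟨R, hR, α, hα, W, hW, hU, hnot⟩ := eternalViscousRate_fails_at_scale ε₀ hε₀ hε₀le a ha
  exact hnot (h R hR α hα 1 W one_pos hW hU)

end Summit.NavierStokesRegularity.NavierStokesRegularity.Theorems.WakeRatchetCircuitPumpNoUniform

end
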